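import Summits.ResolutionOfSingularities.ResolutionOfSingularities.Theorems.UniversalCellsLocalToGlobalSplit
import Summits.ResolutionOfSingularities.ResolutionOfSingularities.Theorems.UniversalCellsLocalToGlobalCoverPatchingOfTrdegLe
import Summits.ResolutionOfSingularities.ResolutionOfSingularities.Theorems.UniversalCellsLocalToGlobalTwoModelPatchingAtOfResolvableDimLe
import Summits.ResolutionOfSingularities.ResolutionOfSingularities.Theorems.PAlterationPialtAtomsOpenRange
import HarnessLib

/-!
# ResolutionOfSingularities / UniversalCells — crux `LocalToGlobal`, line `birth` v3:
# the DIMENSION-GRADED certificates (first open slice = two-model patching over `𝔽_p` in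
# transcendence degree 4)

Crux `stmt-ResolutionOfSingularities-15232`, decl `UniversalCells.LocalToGlobal`
(`∀ p prime, H_p → R_p`: pointwise Zariski-local resolvability of every integral separated
finite-type `𝔽_p`-scheme ⇒ resolution of every such scheme). Skeleton v3 of line `birth`
(`Cruxes/LocalToGlobal/Lines/birth.lean`) runs the crux-strategist's dimension split
(`Theorems.LocalToGlobal_of_subs`, `UniversalCellsLocalToGlobalSplit.lean`): child 1
`OpenPatchingDimLeFour` (Zariski-open patching of two partial resolutions of integral
`𝔽_p`-varieties of dimension `≤ 4`, `H_p`-free) and child 2 `LocalToGlobalDimGeFive` (the crux in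
dimension `> 4`, parked). With the two TRUE stubs of the line landed —
`Theorems.stub_coverPatching_of_trdegLe` (two-model patching of proper models of function fields
of transcendence degree `≤ n` over `k` patches two partial resolutions of a `k`-variety of
dimension `≤ n`) and `Theorems.stub_twoModelPatchingAt_of_resolvable_dimLe` (resolution in
dimension `≤ n` gives two-model patching in transcendence degree `≤ n`) — this file records,
sorry-free:

* `openPatchingDimLeFour_of_twoModelPatching_primeField_trdeg_four` — **child 1 from the printed
  input and ONE atom**: `CossartPiltant2019` (Cossart–Piltant 2019 Thm. 1.1, a named fact of the
  tree; it gives two-model patching in trdeg `≤ 3`, `Pialt.OpenRange.twoModelPatching_of_trdeg_le_three`)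
  and two-model patching of proper models of function fields of transcendence degree EXACTLY `4`
  over `𝔽_p` (Zariski 1944 / Piltant 2013 Prop. 5.1 with `P = P_reg` in its first open
  transcendence degree, at the prime field — the registered atom
  `stub_twoModelPatching_primeField_trdeg_four` of the line) imply child 1.
* `localToGlobal_of_cossartPiltant2019_of_trdeg_four_of_dimGeFive` — hence **the crux CLOSED
  MODULO** `CossartPiltant2019`, the atom, and child 2 (the skeleton v3 with its three open stubs
  as hypotheses; a CONDITIONAL result, the crux item stays open).
* `openPatchingDimLe_iff_resolvableDimLe`, `resolvableDimLe_iff_twoModelPatching_primeField_trdegLe`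
  — **the dimension-graded NO-SLACK cycle**: under the crux's antecedent `H_p`, for every `n : ℕ`,
  open patching over `𝔽_p` in dimension `≤ n` ⇔ resolution of integral `𝔽_p`-varieties of
  dimension `≤ n` ⇔ two-model patching of proper models of function fields of transcendence
  degree `≤ n` over `𝔽_p`. At `n = 4`: child 1 is, under `H_p`, EXACTLY Piltant's two-model
  patching over the prime field in transcendence degree `≤ 4` — the dimension-4 slice of the atom
  of the sibling crux `Valuative.PatchingRel` (stmt-0642, prepared child `PatchingRelDimLeFour`)
  at `k = 𝔽_p`, and PAlteration's residue `TMP_K` in its first open transcendence degree. This is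
  the graded form of the gen-1 certificates `localToGlobal_iff_openPatching` /
  `localToGlobal_iff_twoModelPatchingAt` (`UniversalCellsLocalToGlobalReductions.lean`).

## References

* O. Zariski, Ann. of Math. 45 (1944) 472–542, Fundamental Theorem p. 539. [Zariski1944]
* O. Piltant, RACSAM 107 (2013) 91–121, Prop. 5.1 and p. 2. [Piltant2013]
* V. Cossart, O. Piltant, J. Algebra 529 (2019), Thm. 1.1. [CossartPiltant2019]
* Y. Hu, arXiv:2109.02968 (2021), p. 65. [Hu2021]
-/

-- `Summit.<Summit>.<Sub>.Theorems` with `Sub = Summit` (single-conjunct summit, D-0017)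
set_option linter.dupNamespace false

noncomputable section

open CategoryTheory AlgebraicGeometry TopologicalSpace
open Literature.AlgebraicGeometry.Resolution
open Summit.ResolutionOfSingularities.ResolutionOfSingularities.Theses.UniversalCells (LocalToGlobal)

namespace Summit.ResolutionOfSingularities.ResolutionOfSingularities.Theorems

/-! ## Child 1 from the printed input and the atom -/

/-- A transcendence degree that is `≤ 4` but not `≤ 3` equals `4` (it is a natural number).
[folklore] -/
theorem trdeg_eq_four_of_le_four_of_not_le_three {k K : Type} [Field k] [Field K] [Algebra k K]
    (h4 : Algebra.trdeg k K ≤ 4) (h3 : ¬ Algebra.trdeg k K ≤ 3) : Algebra.trdeg k K = 4 := by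
  obtain ⟨m, hm⟩ : ∃ m : ℕ, Algebra.trdeg k K = m :=
    Cardinal.lt_aleph0.mp (lt_of_le_of_lt h4 (Cardinal.natCast_lt_aleph0 (n := 4)))
  rw [hm] at h4 h3 ⊢
  have h4' : m ≤ 4 := by exact_mod_cast h4
  have h3' : ¬ m ≤ 3 := fun h => h3 (by exact_mod_cast h)
  have : m = 4 := by omega
  exact_mod_cast this

/-- **Two-model patching over `𝔽_p` in transcendence degree `≤ 4` from the printed input and the
atom**: `CossartPiltant2019` settles trdeg `≤ 3` (`twoModelPatching_of_trdeg_le_three`: resolve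
the join), the atom is trdeg `= 4`. [cite: CossartPiltant2019, Thm. 1.1; Piltant2013, Prop. 5.1] -/
theorem twoModelPatching_primeField_trdeg_le_four (hCP : CossartPiltant2019.{0})
    (hC : ∀ (p : ℕ) [Fact p.Prime] (K : Type) [Field K] [Algebra (ZMod p) K]
      [Algebra.EssFiniteType (ZMod p) K], Algebra.trdeg (ZMod p) K = 4 →
      ∀ M₁ M₂ : ProperModel (ZMod p) K,
        ∃ (N : ProperModel (ZMod p) K) (φ₁ : N.Hom M₁) (φ₂ : N.Hom M₂), φ₁.RegLe ∧ φ₂.RegLe)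
    (p : ℕ) [Fact p.Prime] (K : Type) [Field K] [Algebra (ZMod p) K]
    [Algebra.EssFiniteType (ZMod p) K] (hK : Algebra.trdeg (ZMod p) K ≤ 4)
    (M₁ M₂ : ProperModel (ZMod p) K) :
    ∃ (N : ProperModel (ZMod p) K) (φ₁ : N.Hom M₁) (φ₂ : N.Hom M₂), φ₁.RegLe ∧ φ₂.RegLe := by
  by_cases h3 : Algebra.trdeg (ZMod p) K ≤ 3
  · exact Pialt.OpenRange.twoModelPatching_of_trdeg_le_three hCP h3 M₁ M₂
  · exact hC p K (trdeg_eq_four_of_le_four_of_not_le_three hK h3) M₁ M₂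

/-- **Child 1 `OpenPatchingDimLeFour` of the dimension split from `CossartPiltant2019` and ONE
atom** — two-model patching of proper models of function fields of transcendence degree `4` over
the prime field `𝔽_p` (Zariski 1944 Fundamental Theorem / Piltant 2013 Prop. 5.1 with
`P = P_reg`, first open transcendence degree): feed two-model patching over `𝔽_p` in trdeg `≤ 4`
into the trdeg-bounded open patching `stub_coverPatching_of_trdegLe` at `k = 𝔽_p`, `n = 4`.
A CONDITIONAL result (both hypotheses are open/unproved in the tree).
[cite: Piltant2013, Prop. 5.1 and p. 2; CossartPiltant2019, Thm. 1.1] -/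
theorem openPatchingDimLeFour_of_twoModelPatching_primeField_trdeg_four
    (hCP : CossartPiltant2019.{0})
    (hC : ∀ (p : ℕ) [Fact p.Prime] (K : Type) [Field K] [Algebra (ZMod p) K]
      [Algebra.EssFiniteType (ZMod p) K], Algebra.trdeg (ZMod p) K = 4 →
      ∀ M₁ M₂ : ProperModel (ZMod p) K,
        ∃ (N : ProperModel (ZMod p) K) (φ₁ : N.Hom M₁) (φ₂ : N.Hom M₂), φ₁.RegLe ∧ φ₂.RegLe)
    (p : ℕ) (hp : p.Prime) (X : Scheme.{0}) (f : X ⟶ Spec (.of (ZMod p))) (hs : IsSeparated f)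
    (hl : LocallyOfFiniteType f) (hq : QuasiCompact f) (hi : IsIntegral X)
    (hX : topologicalKrullDim X ≤ 4) (U V : X.Opens) (hUV : U ⊔ V = ⊤)
    (hU : ∃ (Z : Scheme.{0}) (π : Z ⟶ X), IsIntegral Z ∧ IsProper π ∧ IsBirational π ∧
      ∀ z : Z, π.base z ∈ U → IsRegularLocalRing (Z.presheaf.stalk z))
    (hV : ∃ (Z : Scheme.{0}) (π : Z ⟶ X), IsIntegral Z ∧ IsProper π ∧ IsBirational π ∧
      ∀ z : Z, π.base z ∈ V → IsRegularLocalRing (Z.presheaf.stalk z)) :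
    Scheme.HasResolution X := by
  haveI : Fact p.Prime := ⟨hp⟩
  obtain ⟨Z₁, π₁, hZ₁, hπ₁, hb₁, hr₁⟩ := hU
  obtain ⟨Z₂, π₂, hZ₂, hπ₂, hb₂, hr₂⟩ := hV
  haveI := hs; haveI := hl; haveI := hq; haveI := hi
  haveI := hZ₁; haveI := hπ₁; haveI := hZ₂; haveI := hπ₂
  have hX' : topologicalKrullDim X ≤ (4 : ℕ) := by exact_mod_cast hX
  exact stub_coverPatching_of_trdegLe (ZMod p) 4
    (fun K _ _ _ hK M₁ M₂ => twoModelPatching_primeField_trdeg_le_four hCP hC p K hK M₁ M₂)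
    X f hX' U V hUV π₁ π₂ hb₁ hb₂ hr₁ hr₂

/-- **The crux `LocalToGlobal` CLOSED MODULO `CossartPiltant2019`, the transcendence-degree-4
atom over `𝔽_p`, and its own dimension-`≥ 5` remainder** (skeleton v3 of line `birth` with its
three open stubs as hypotheses): child 1 by
`openPatchingDimLeFour_of_twoModelPatching_primeField_trdeg_four`, glued with child 2 by the landed
`LocalToGlobal_of_subs` (case split on `topologicalKrullDim X ≤ 4`; below the bound the crux's
antecedent is consumed once, by the finite subcover). A CONDITIONAL result: the item stays open.
[cite: Piltant2013, Prop. 5.1 and p. 2; CossartPiltant2019, Thm. 1.1; Hu2021, p. 65] -/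
theorem localToGlobal_of_cossartPiltant2019_of_trdeg_four_of_dimGeFive
    (hCP : CossartPiltant2019.{0})
    (hC : ∀ (p : ℕ) [Fact p.Prime] (K : Type) [Field K] [Algebra (ZMod p) K]
      [Algebra.EssFiniteType (ZMod p) K], Algebra.trdeg (ZMod p) K = 4 →
      ∀ M₁ M₂ : ProperModel (ZMod p) K,
        ∃ (N : ProperModel (ZMod p) K) (φ₁ : N.Hom M₁) (φ₂ : N.Hom M₂), φ₁.RegLe ∧ φ₂.RegLe)
    (hD : ∀ p : ℕ, p.Prime → (∀ (X : Scheme.{0}) (f : X ⟶ Spec (.of (ZMod p))), IsSeparated f →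
      LocallyOfFiniteType f → QuasiCompact f → IsIntegral X → ∀ x : X, ∃ U : X.Opens, x ∈ U ∧
        Scheme.HasResolution (U : Scheme.{0})) →
      ∀ (X : Scheme.{0}) (f : X ⟶ Spec (.of (ZMod p))), IsSeparated f → LocallyOfFiniteType f →
      QuasiCompact f → IsIntegral X → ¬ topologicalKrullDim X ≤ 4 → Scheme.HasResolution X) :
    LocalToGlobal :=
  LocalToGlobal_of_subs
    (fun p hp X f hs hl hq hi hX U V hUV hU hV =>
      openPatchingDimLeFour_of_twoModelPatching_primeField_trdeg_four hCP hC p hp X f hs hl hq hi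
        hX U V hUV hU hV)
    hD

/-! ## The dimension-graded no-slack cycle under `H_p` -/

/-- **Under `H_p`, open patching over `𝔽_p` in dimension `≤ n` ⇔ resolution of integral
`𝔽_p`-varieties of dimension `≤ n`.** `→`: the dimension-bounded cover induction
`hasResolution_of_binaryUnion_of_dim_le` over binary unions assembled from `stub_extension`
(Nagata, a theorem of the tree) twice and open patching; `←`: a resolution of `X` patches anything.
[cite: Hu2021, p. 65] -/
theorem openPatchingDimLe_iff_resolvableDimLe (p : ℕ) (hp : p.Prime) (n : WithBot ℕ∞)
    (hloc : ∀ (X : Scheme.{0}) (f : X ⟶ Spec (.of (ZMod p))), IsSeparated f →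
      LocallyOfFiniteType f → QuasiCompact f → IsIntegral X →
        ∀ x : X, ∃ U : X.Opens, x ∈ U ∧ Scheme.HasResolution (U : Scheme.{0})) :
    (∀ (X : Scheme.{0}) (f : X ⟶ Spec (.of (ZMod p))), IsSeparated f → LocallyOfFiniteType f →
      QuasiCompact f → IsIntegral X → topologicalKrullDim X ≤ n → ∀ U V : X.Opens, U ⊔ V = ⊤ →
        (∃ (Z : Scheme.{0}) (π : Z ⟶ X), IsIntegral Z ∧ IsProper π ∧ IsBirational π ∧
          ∀ z : Z, π.base z ∈ U → IsRegularLocalRing (Z.presheaf.stalk z)) →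
        (∃ (Z : Scheme.{0}) (π : Z ⟶ X), IsIntegral Z ∧ IsProper π ∧ IsBirational π ∧
          ∀ z : Z, π.base z ∈ V → IsRegularLocalRing (Z.presheaf.stalk z)) →
          Scheme.HasResolution X) ↔
    (∀ (X : Scheme.{0}) (f : X ⟶ Spec (.of (ZMod p))), IsSeparated f → LocallyOfFiniteType f →
      QuasiCompact f → IsIntegral X → topologicalKrullDim X ≤ n → Scheme.HasResolution X) := by
  constructor
  · intro hOP X f hs hl hq hi hX
    exact hasResolution_of_binaryUnion_of_dim_le p hp n hloc
      (fun Y g hs' hl' hq' hi' hY U V hUV hU hV =>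
        hOP Y g hs' hl' hq' hi' hY U V hUV (stub_extension p hp Y g hs' hl' hq' hi' U hU)
          (stub_extension p hp Y g hs' hl' hq' hi' V hV))
      X f hs hl hq hi hX
  · intro hR X f hs hl hq hi hX _ _ _ _ _
    exact hR X f hs hl hq hi hX

/-- **Resolution of integral `𝔽_p`-varieties of dimension `≤ n` ⇔ two-model patching of proper
models of function fields of transcendence degree `≤ n` over `𝔽_p`, under `H_p`** (`n : ℕ`).
`→` (no `H_p` needed): resolve the join (`stub_twoModelPatchingAt_of_resolvable_dimLe`);
`←`: two-model patching in trdeg `≤ n` gives open patching in dimension `≤ n`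
(`stub_coverPatching_of_trdegLe` at `k = 𝔽_p`), hence resolution in dimension `≤ n` under `H_p`
(`openPatchingDimLe_iff_resolvableDimLe`). At `n = 4` this pins child 1 of the split, under the
crux's own antecedent, EXACTLY on Piltant's two-model patching over the prime field in
transcendence degree `≤ 4`. [cite: Piltant2013, Prop. 5.1 and p. 2; ZariskiSamuel1960, Ch. VI §17] -/
theorem resolvableDimLe_iff_twoModelPatching_primeField_trdegLe (p : ℕ) [hp : Fact p.Prime]
    (n : ℕ)
    (hloc : ∀ (X : Scheme.{0}) (f : X ⟶ Spec (.of (ZMod p))), IsSeparated f →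
      LocallyOfFiniteType f → QuasiCompact f → IsIntegral X →
        ∀ x : X, ∃ U : X.Opens, x ∈ U ∧ Scheme.HasResolution (U : Scheme.{0})) :
    (∀ (X : Scheme.{0}) (f : X ⟶ Spec (.of (ZMod p))), IsSeparated f → LocallyOfFiniteType f →
      QuasiCompact f → IsIntegral X → topologicalKrullDim X ≤ n → Scheme.HasResolution X) ↔
    (∀ (K : Type) [Field K] [Algebra (ZMod p) K] [Algebra.EssFiniteType (ZMod p) K],
      Algebra.trdeg (ZMod p) K ≤ n → ∀ M₁ M₂ : ProperModel (ZMod p) K,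
        ∃ (N : ProperModel (ZMod p) K) (φ₁ : N.Hom M₁) (φ₂ : N.Hom M₂), φ₁.RegLe ∧ φ₂.RegLe) := by
  constructor
  · intro hR K _ _ _ hK M₁ M₂
    exact stub_twoModelPatchingAt_of_resolvable_dimLe (ZMod p) n hR K hK M₁ M₂
  · intro hT
    refine (openPatchingDimLe_iff_resolvableDimLe p hp.out n hloc).mp ?_
    intro X f hs hl hq hi hX U V hUV hU hV
    obtain ⟨Z₁, π₁, hZ₁, hπ₁, hb₁, hr₁⟩ := hU
    obtain ⟨Z₂, π₂, hZ₂, hπ₂, hb₂, hr₂⟩ := hV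
    haveI := hs; haveI := hl; haveI := hq; haveI := hi
    haveI := hZ₁; haveI := hπ₁; haveI := hZ₂; haveI := hπ₂
    exact stub_coverPatching_of_trdegLe (ZMod p) n hT X f hX U V hUV π₁ π₂ hb₁ hb₂ hr₁ hr₂

end Summit.ResolutionOfSingularities.ResolutionOfSingularities.Theorems

end
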